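import Summits.BirchSwinnertonDyer.BirchSwinnertonDyer.Theorems.KatoDescentPotSupersingularWildUpperDivisionFieldFukudaDoor
import Literature.NumberTheory.EllipticCurves.FineSelmerLayerCriterionRat
import Literature.NumberTheory.EllipticCurves.CyclotomicZpExtensionLayerSplitPrimesProofs
import HarnessLib

/-!
# Route `KatoDescentPotSupersingular` (rung K9, sub-rung B5 = O6 wild `p = 3`, cell `bsd-potss`): DOOR L5 AT LAYER 1 as a FACT-FREE per-row
# road — statement (A) of Coates–Sujatha at `(E, 3)` from `Δ(E)` a cube and ONE class-group datum of the layer `L₁ = ℚ(E[3])·ℚ₁` of the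
# cyclotomic `ℤ₃`-tower (`ℚ₁ = ℚ(ζ₉)⁺`), with NOTHING assumed at `3` (so rows with `E(ℚ₃)[3] ≠ 0` are served); U₀ (`ord₃ #Ш ≤ ord₃ #Ш_an`) from the
# same data modulo `hKatoA hGZK hmod` only
# (seat `bsd-potss-k9-c4` g25; route-free TOOL; `--supports stmt-BirchSwinnertonDyer-19197 --as helper`)

HONEST FRAMING. THEOREMS ONLY (no definition, no named fact, no `sorry`); a DOOR, not a class theorem; nothing is booked; items 19189 / 19197 /
19942 / 19386 stay OPEN at class level (class-wide open input of record: the zeta crux 24327); Conjecture A and BSD are proved for NO class of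
curves here.  WHAT IS NEW.  conjA-anchor g18's door L5 is a KERNEL THEOREM since 2026-08-29
(`Literature/…/FineSelmerLayerCriterionRat.lean`: `CoatesSujatha2005.conjA_of_homTrivial_layer'` — (c1) `p ∤ #Gal(ℚ(E[p])/ℚ)` + (c2)_{S,n+1} «every
`Γ_ℚ`-equivariant additive `Cl(𝓞_{L_{n+1}}) → E[p]` killing the classes above `p` and above the bad places is `0`» + per bad place (c3′) «`q` not
completely split in `ℚ_{n+1}`» or (c3) «`E[p]^{D_q} = 0`» ⟹ (A); NO condition at `p`; `H²`-free descent, NO named fact) together with the arithmetic form of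
(c3′) (`…/CyclotomicZpExtensionLayerSplitPrimesProofs.lean`: `q^{p-1} % p^{n+2} ≠ 1 ⟹ ¬ (D_q ≤ Gal(ℚ̄/ℚ_{n+1}))`).  THIS FILE packages it for the K9
record lane at `p = 3`, LAYER 1 (`n = 0`), in the currency the per-row kernel certificates and conjA-anchor g15's layer-1 class-group engine
(`drsl1.gp` / `l5layer1p.gp`, kit j313803 / j314664 / j314667) provide:
* (c1) from `E[3]` IRREDUCIBLE and `Δ(E)` a CUBE (tree `DivisionFieldFukudaDoor.not_dvd_card_aut_divisionField_three_of_Δ_eq_cube`, k9-c4 g22);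
* (c3′)₁ at a bad prime `q ≠ 3` with `q² % 9 ≠ 1` (`q ≢ ±1 (mod 9)`: `q` inert in `ℚ₁`) — KERNEL, `decide` per prime (`not_decomp_le_layerSubgroup_one`);
  (c3) at the other bad primes DISPLAYED in the `E[3]`-currency («no non-zero point of `E[3]` is fixed by the decomposition group at `q`», i.e.
  `E(ℚ_q)[3] = 0`);
* the class-group datum of `L₁ = W.divisionField 3 ⊔ κ.layer 1` (degree `3·#Gal(ℚ(E[3])/ℚ)` = 24 for `3Ns`, 48 for `3Nn`) in THREE displayed shapes, all
  quantified over every cyclotomic `κ` (they share the layer `ℚ₁`):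
  (E) equivariant — (c2)_{S,1} verbatim (rows whose `S`-split `3`-class group is non-zero but carries no `E[3]`: kit column `r3S > 0`, `rho = [0,·]`);
  (S) `S`-classes GENERATE `Cl(L₁) ⊗ 𝔽₃` — «every additive `Cl(𝓞_{L₁}) → E[3]` killing the classes above `3` and the bad primes is `0`», no
  equivariance (kit column `r3S = 0`);
  (C) `3 ∤ h(L₁)` — ONE integer, no bad-prime data at all (door L5 with `bad = ∅`).
Each shape gives (A) at `(E,3)` for every cyclotomic `ℤ₃`-extension with NO NAMED FACT, and U₀ `MissingUpperBoundAt E 3` at a K9 row (`r_an = 0`,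
`ClassO6 E 3`, `E[3]` irreducible) modulo the three named facts `hKatoA` (Kato 14.5 (3), fine-Selmer reading), `hGZK`, `hmod` (through k9-c4 g5's
`WildFineSelmerSupersingularCMAnchor.missingUpperBoundAt_wild_of_conjA`).

Scope (conjA-anchor g15 door-L5 census at layer 1, memo §8; K9 table of 364 U₀-ns rows): the 76 rows with `E(ℚ₃)[3] ≠ 0` have NO door-L6 / Deo–Ray–Sujatha
certificate at any layer; for 57 of them (51 `3Ns` incl. the SIX 19942 residue rows 28566bk1 228150bi1 228150bv1 272214x1 320166gm1 371358bt1, and 6 `3Nn`)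
(c2)_{S,1} HOLDS (GRH class groups of `L₁`) and every bad prime is either inert in `ℚ₁` or has `E(ℚ_q)[3] = 0` — files `…WildFineSelmerLayerOneL5Records0k`
record them through THIS door: their first (A) records free of `μ`-inputs, Ferrero–Washington, Fukuda and anchors.  NOT served: 117504e1 (bad `17 ≡ −1 (9)`
with `E(ℚ₁₇)[3] ≠ 0`: layer 2), the 14 rows where (c2)_{S,1} FAILS (door void at every layer), the `GL₂(𝔽₃)` rows ((c1) fails).

References: [CoatesSujatha2005] Thm. 3.4, Lemma 3.8; [DeoRaySujatha2023] Thm. 3.8 (c1)(c2)(c3) (arXiv:2202.09937 p. 9); [RaySujatha2025] Cor. 3.7;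
[LimSujatha2018] §3; [Washington1997] §13.1; [Marcus2018] Ch. 4 Ex. 12(a); [Serre1972] §2.4 Prop. 15, §5.3; [Kato2004Asterisque] Thm. 14.5 (3), Prop. 14.16 (2).
-/

set_option autoImplicit false
set_option linter.dupNamespace false

noncomputable section

open scoped Classical NumberField nonZeroDivisors
open WeierstrassCurve NumberField Field IsDedekindDomain IntermediateField
  Literature.NumberTheory.EllipticCurves Literature.NumberTheory.EllipticCurves.Rank1Residual
  Literature.NumberTheory.EllipticCurves.Rank1Residual.Typed
  Literature.NumberTheory.GaloisRepresentations Literature.NumberTheory.NumberFields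
  Literature.NumberTheory.SerreUniformity Literature.NumberTheory.IwasawaTheory
  Summit.BirchSwinnertonDyer.Rank1Residual Summit.BirchSwinnertonDyer.Rank1Residual.Additive
  Summit.BirchSwinnertonDyer.BirchSwinnertonDyer.Theorems

namespace Summit.BirchSwinnertonDyer.BirchSwinnertonDyer.Theorems.WildFineSelmerLayerOneL5Door

/-! ## §0 Two folklore helpers -/

/-- `E[3]` (the geometric `3`-torsion `geomTorsion W 3`) is killed by `3`. [folklore] -/
theorem three_nsmul_geomTorsion_eq_zero (W : WeierstrassCurve ℚ) [W.IsElliptic]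
    (v : geomTorsion W ((3 : ℕ) : ℤ)) : 3 • v = 0 := by
  apply Subtype.ext
  have hv : ((v : geomTorsion W ((3 : ℕ) : ℤ)) : geomPoints W) ∈
      AddSubgroup.torsionBy (geomPoints W) ((3 : ℕ) : ℤ) := v.2
  rw [AddSubgroup.torsionBy, Submodule.mem_toAddSubgroup, Submodule.mem_torsionBy_iff] at hv
  rw [AddSubgroupClass.coe_nsmul, ZeroMemClass.coe_zero, ← natCast_zsmul]
  exact hv

/-- An additive map from a finite abelian group of order prime to `3` to a `3`-torsion abelian group is zero. [folklore] -/
theorem addMonoidHom_eq_zero_of_not_three_dvd_card {G : Type*} [CommGroup G] [Finite G]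
    (hG : ¬ 3 ∣ Nat.card G) {V : Type*} [AddCommGroup V] (hV : ∀ v : V, 3 • v = 0)
    (μ : Additive G →+ V) : μ = 0 := by
  refine AddMonoidHom.ext fun a => ?_
  have ha : Nat.card G • a = 0 := by
    rw [← ofMul_toMul a, ← ofMul_pow, pow_card_eq_one', ofMul_one]
  have h1 : ((Nat.card G : ℕ) : ℤ) • μ a = 0 := by
    rw [natCast_zsmul, ← map_nsmul, ha, map_zero]
  have h2 : ((3 : ℕ) : ℤ) • μ a = 0 := by rw [natCast_zsmul, hV]
  have hcop : IsCoprime (Nat.card G : ℤ) ((3 : ℕ) : ℤ) :=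
    Nat.isCoprime_iff_coprime.mpr (Nat.coprime_comm.mp ((Nat.Prime.coprime_iff_not_dvd Nat.prime_three).mpr hG))
  obtain ⟨u, v, huv⟩ := hcop
  have h : (u * (Nat.card G : ℤ) + v * ((3 : ℕ) : ℤ)) • μ a = 0 := by
    rw [add_smul, mul_smul, mul_smul, h1, h2, smul_zero, smul_zero, add_zero]
  rwa [huv, one_smul] at h

/-! ## §1 (c3′) at `p = 3`, layer 1: a bad prime `q ≢ ±1 (mod 9)` is inert in `ℚ₁` -/

/-- **(c3′)₁ at `p = 3` from `q² % 9 ≠ 1`.**  For a cyclotomic `ℤ₃`-extension `κ` of `ℚ`, a place `u` of `ℚ` containing the prime `q ≠ 3` with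
`q² ≢ 1 (mod 9)` (i.e. `q ≢ ±1 (mod 9)`): the chosen decomposition group `D_u` is NOT contained in `κ.layerSubgroup 1 = Gal(ℚ̄/ℚ₁)` — `q` does not split
in the cubic field `ℚ₁ = ℚ(ζ₉)⁺`.  One call of conjA-anchor g18's `ZpExtension.IsCyclotomic.not_decomp_le_layerSubgroup_succ_of_natCast_mem` (`n = 0`);
the first disjunct of `hbad` in `CoatesSujatha2005.conjA_of_homTrivial_layer'`.  Per prime the side conditions are `decide`/`norm_num`.
[cite: Marcus2018, Ch. 4 Exercise 12(a); Ch. 7, proof of Cor. 3 of Thm. 43] [cite: Washington1997, §13.1] -/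
theorem not_decomp_le_layerSubgroup_one {κ : ZpExtension ℚ 3} (hκ : κ.IsCyclotomic)
    {u : HeightOneSpectrum (𝓞 ℚ)} {q : ℕ} (hq : q.Prime) (hqu : (q : 𝓞 ℚ) ∈ u.asIdeal) (hq3 : q ≠ 3)
    (hmod : q ^ 2 % 9 ≠ 1) : ¬ (GreenbergSelmer.decomp u ≤ κ.layerSubgroup (0 + 1)) :=
  haveI : Fact (Nat.Prime 3) := ⟨Nat.prime_three⟩
  ZpExtension.IsCyclotomic.not_decomp_le_layerSubgroup_succ_of_natCast_mem hκ (by decide) 0 hq hqu hq3 hmod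

/-! ## §2 Door L5 at layer 1, EQUIVARIANT form (E): (c2)_{S,1} verbatim -/

/-- **(A) at `(E, 3)` with NO named fact — door L5 at layer 1, equivariant form (E).**  `E/ℚ` elliptic (`W`), `E[3]` irreducible, `Δ(E) = d³`
(⟹ `3 ∤ #Gal(ℚ(E[3])/ℚ)`, (c1)); a set `bad` of places of `ℚ`, each — for every cyclotomic `κ` — of type (c3′)₁ (`¬ (D_q ≤ Gal(ℚ̄/ℚ₁))`) or (c3)
(`E[3]^{D_q} = 0`); and (c2)_{S,1}: for every cyclotomic `κ`, every additive `Γ_ℚ`-equivariant `Cl(𝓞_{L₁}) → E[3]`, `L₁ = W.divisionField 3 ⊔ κ.layer 1`,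
killing the classes of the primes of `L₁` above `3` and above `bad` is `0`.  Then statement (A) holds at `(E, 3)` for every cyclotomic `ℤ₃`-extension.
NOTHING at `3` beyond (c1).  One call of conjA-anchor g18's `CoatesSujatha2005.conjA_of_homTrivial_layer'` (`n = 0`).
[cite: CoatesSujatha2005, §3 Thm. 3.4 and Lemma 3.8] [cite: DeoRaySujatha2023, §3 Thm. 3.8 (c1), (c2), H′_L (arXiv:2202.09937 p. 9)]
[cite: Serre1972, §2.4 Prop. 15, §5.3] -/
theorem conjA_three_layer_one_of_Δ_eq_cube (W : WeierstrassCurve ℚ) [W.IsElliptic]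
    (hirr : W.HasIrreducibleModPGaloisRep 3) {d : ℚ} (hΔ : W.Δ = d ^ 3)
    (bad : HeightOneSpectrum (𝓞 ℚ) → Prop)
    (hbad : ∀ κ : ZpExtension ℚ 3, κ.IsCyclotomic → ∀ u : HeightOneSpectrum (𝓞 ℚ), bad u →
      ¬ (GreenbergSelmer.decomp u ≤ κ.layerSubgroup (0 + 1)) ∨
      (∀ x : geomTorsion W ((3 : ℕ) : ℤ), (∀ δ ∈ GreenbergSelmer.decomp u, δ • x = x) → x = 0))
    (hL5 : ∀ κ : ZpExtension ℚ 3, κ.IsCyclotomic →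
      haveI := κ.isGalois_layer_holds (0 + 1)
      haveI := κ.finiteDimensional_layer_holds (0 + 1)
      haveI : NumberField ↥(W.divisionField 3 ⊔ κ.layer (0 + 1)) := NumberField.of_module_finite ℚ _
      ∀ (f : Additive (ClassGroup (𝓞 ↥(W.divisionField 3 ⊔ κ.layer (0 + 1)))) →+ geomTorsion W ((3 : ℕ) : ℤ)),
      (∀ (τ : absoluteGaloisGroup ℚ) (c : ClassGroup (𝓞 ↥(W.divisionField 3 ⊔ κ.layer (0 + 1)))),
        f (Additive.ofMul (ClassGroup.mulEquiv (AmbiguousClass.intAut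
          (absRestrictNormalHom (W.divisionField 3 ⊔ κ.layer (0 + 1)) τ)) c)) = τ • f (Additive.ofMul c)) →
      (∀ (w : HeightOneSpectrum (𝓞 ↥(W.divisionField 3 ⊔ κ.layer (0 + 1)))) (u : HeightOneSpectrum (𝓞 ℚ)),
          (((3 : ℕ) : 𝓞 ℚ) ∈ u.asIdeal ∨ bad u) → w.asIdeal.under (𝓞 ℚ) = u.asIdeal →
        f (Additive.ofMul (ClassGroup.mk0 ⟨w.asIdeal, mem_nonZeroDivisors_of_ne_zero w.ne_bot⟩)) = 0) →
      f = 0)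
    (κ : ZpExtension ℚ 3) (hκ : κ.IsCyclotomic) :
    ∃ (γ : absoluteGaloisGroup ℚ) (D : W.FineSelmerDualData κ γ),
      Module.Finite ℤ_[3] (RestrictScalars ℤ_[3] (IwasawaAlgebra 3) D.X) := by
  haveI : Fact (Nat.Prime 3) := ⟨Nat.prime_three⟩
  exact CoatesSujatha2005.conjA_of_homTrivial_layer' W (by decide)
    (DivisionFieldFukudaDoor.not_dvd_card_aut_divisionField_three_of_Δ_eq_cube W hirr hΔ) hκ 0 bad (hbad κ hκ) (hL5 κ hκ)

/-! ## §3 Door L5 at layer 1, S-form (S): the S-classes generate `Cl(L₁) ⊗ 𝔽₃` -/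

/-- **(A) at `(E, 3)` with NO named fact — door L5 at layer 1, S-form (S).**  As (E), the class-group datum being the NON-equivariant «for every
cyclotomic `κ`, every additive `Cl(𝓞_{L₁}) → E[3]` killing the classes of the primes of `L₁` above `3` and above `bad` is `0`» — numerically: the `3`-part
of `Cl(L₁)/⟨S-classes⟩` is trivial (kit column `r3S = 0`).  A fortiori (c2)_{S,1}.
[cite: CoatesSujatha2005, §3 Thm. 3.4 and Lemma 3.8] [cite: DeoRaySujatha2023, §3 Thm. 3.8 (c1), (c2), H′_L (arXiv:2202.09937 p. 9)]
[cite: Serre1972, §2.4 Prop. 15, §5.3] -/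
theorem conjA_three_layer_one_of_Δ_eq_cube_of_sClasses (W : WeierstrassCurve ℚ) [W.IsElliptic]
    (hirr : W.HasIrreducibleModPGaloisRep 3) {d : ℚ} (hΔ : W.Δ = d ^ 3)
    (bad : HeightOneSpectrum (𝓞 ℚ) → Prop)
    (hbad : ∀ κ : ZpExtension ℚ 3, κ.IsCyclotomic → ∀ u : HeightOneSpectrum (𝓞 ℚ), bad u →
      ¬ (GreenbergSelmer.decomp u ≤ κ.layerSubgroup (0 + 1)) ∨
      (∀ x : geomTorsion W ((3 : ℕ) : ℤ), (∀ δ ∈ GreenbergSelmer.decomp u, δ • x = x) → x = 0))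
    (hS : ∀ κ : ZpExtension ℚ 3, κ.IsCyclotomic →
      haveI := κ.isGalois_layer_holds (0 + 1)
      haveI := κ.finiteDimensional_layer_holds (0 + 1)
      haveI : NumberField ↥(W.divisionField 3 ⊔ κ.layer (0 + 1)) := NumberField.of_module_finite ℚ _
      ∀ (f : Additive (ClassGroup (𝓞 ↥(W.divisionField 3 ⊔ κ.layer (0 + 1)))) →+ geomTorsion W ((3 : ℕ) : ℤ)),
      (∀ (w : HeightOneSpectrum (𝓞 ↥(W.divisionField 3 ⊔ κ.layer (0 + 1)))) (u : HeightOneSpectrum (𝓞 ℚ)),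
          (((3 : ℕ) : 𝓞 ℚ) ∈ u.asIdeal ∨ bad u) → w.asIdeal.under (𝓞 ℚ) = u.asIdeal →
        f (Additive.ofMul (ClassGroup.mk0 ⟨w.asIdeal, mem_nonZeroDivisors_of_ne_zero w.ne_bot⟩)) = 0) →
      f = 0)
    (κ : ZpExtension ℚ 3) (hκ : κ.IsCyclotomic) :
    ∃ (γ : absoluteGaloisGroup ℚ) (D : W.FineSelmerDualData κ γ),
      Module.Finite ℤ_[3] (RestrictScalars ℤ_[3] (IwasawaAlgebra 3) D.X) :=
  conjA_three_layer_one_of_Δ_eq_cube W hirr hΔ bad hbad (fun κ' hκ' f _ hfS => hS κ' hκ' f hfS) κ hκ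

/-! ## §4 Door L5 at layer 1, class-number form (C): `3 ∤ h(L₁)` -/

/-- **(A) at `(E, 3)` with NO named fact — door L5 at layer 1, class-number form (C).**  `E[3]` irreducible, `Δ(E) = d³`, and for every cyclotomic `κ`
the class number of `L₁ = W.divisionField 3 ⊔ κ.layer 1` is prime to `3`.  Then (A) at `(E, 3)` for every cyclotomic `ℤ₃`-extension — NO bad-prime condition
and NOTHING at `3` (door L5 with `bad = ∅`: every additive `Cl(𝓞_{L₁}) → E[3]` is `0` since `E[3]` is `3`-torsion and `#Cl(𝓞_{L₁})` is prime to `3`).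
[cite: CoatesSujatha2005, §3 Thm. 3.4 and Lemma 3.8] [cite: DeoRaySujatha2023, §3 Thm. 3.8 (c1), (c2) (arXiv:2202.09937 p. 9)]
[cite: Serre1972, §2.4 Prop. 15, §5.3] -/
theorem conjA_three_layer_one_of_Δ_eq_cube_of_not_dvd_classNumber (W : WeierstrassCurve ℚ) [W.IsElliptic]
    (hirr : W.HasIrreducibleModPGaloisRep 3) {d : ℚ} (hΔ : W.Δ = d ^ 3)
    (hh : ∀ κ : ZpExtension ℚ 3, κ.IsCyclotomic →
      haveI := κ.isGalois_layer_holds (0 + 1)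
      haveI := κ.finiteDimensional_layer_holds (0 + 1)
      haveI : NumberField ↥(W.divisionField 3 ⊔ κ.layer (0 + 1)) := NumberField.of_module_finite ℚ _
      ¬ 3 ∣ NumberField.classNumber ↥(W.divisionField 3 ⊔ κ.layer (0 + 1)))
    (κ : ZpExtension ℚ 3) (hκ : κ.IsCyclotomic) :
    ∃ (γ : absoluteGaloisGroup ℚ) (D : W.FineSelmerDualData κ γ),
      Module.Finite ℤ_[3] (RestrictScalars ℤ_[3] (IwasawaAlgebra 3) D.X) := by
  haveI : Fact (Nat.Prime 3) := ⟨Nat.prime_three⟩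
  haveI := κ.isGalois_layer_holds (0 + 1)
  haveI := κ.finiteDimensional_layer_holds (0 + 1)
  haveI : NumberField ↥(W.divisionField 3 ⊔ κ.layer (0 + 1)) := NumberField.of_module_finite ℚ _
  refine CoatesSujatha2005.conjA_of_homTrivial_layer_above_p W (by decide)
    (DivisionFieldFukudaDoor.not_dvd_card_aut_divisionField_three_of_Δ_eq_cube W hirr hΔ) hκ 0 ?_
  intro f _ _
  have hh' : ¬ 3 ∣ Nat.card (ClassGroup (𝓞 ↥(W.divisionField 3 ⊔ κ.layer (0 + 1)))) := by
    rw [Nat.card_eq_fintype_card]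
    exact hh κ hκ
  exact addMonoidHom_eq_zero_of_not_three_dvd_card hh' (three_nsmul_geomTorsion_eq_zero W) f

/-! ## §5 U₀ at a K9 row through door L5 (modulo `hKatoA hGZK hmod` only) -/

/-- **U₀ at a K9 row from door L5 at layer 1, equivariant form (E)** — `ord₃ #Ш(E) ≤ ord₃ #Ш(E)_an` (`MissingUpperBoundAt E 3`) for `E/ℚ` globally minimal
with `r_an = 0`, `ClassO6 E 3`, `E[3]` irreducible, `Δ(E)` a cube, `bad`/`hbad`/(c2)_{S,1} as in `conjA_three_layer_one_of_Δ_eq_cube`, modulo the named facts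
`hKatoA` (Kato's Thm. 14.5 (3), fine-Selmer reading), `hGZK`, `hmod` ONLY (k9-c4 g5's `WildFineSelmerSupersingularCMAnchor.missingUpperBoundAt_wild_of_conjA`).
CONDITIONAL on the three displayed facts; nothing booked.
[cite: Kato2004Asterisque, Thm. 14.5 (3) (p. 236) and Prop. 14.16 (2)] [cite: CoatesSujatha2005, §3 Thm. 3.4] [cite: DeoRaySujatha2023, §3 Thm. 3.8] -/
theorem missingUpperBoundAt_three_layer_one_of_Δ_eq_cube
    (hKatoA : Kato2004.rankZero_padicValNat_sha_add_padicValNat_tamagawa_le_of_additive_potGood_of_irreducible_of_fineSelmerDual_fg)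
    (hGZK : rank_eq_analyticRank_of_analyticRank_le_one) (hmod : hasEntireLFunction_rat)
    (W : WeierstrassCurve ℚ) [W.IsElliptic] [W.IsGloballyMinimal] [Fact (3 : ℕ).Prime]
    (hr : W.analyticRank = 0) (hO : ClassO6 W 3) (hirr : W.HasIrreducibleModPGaloisRep 3) {d : ℚ} (hΔ : W.Δ = d ^ 3)
    (bad : HeightOneSpectrum (𝓞 ℚ) → Prop)
    (hbad : ∀ κ : ZpExtension ℚ 3, κ.IsCyclotomic → ∀ u : HeightOneSpectrum (𝓞 ℚ), bad u →
      ¬ (GreenbergSelmer.decomp u ≤ κ.layerSubgroup (0 + 1)) ∨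
      (∀ x : geomTorsion W ((3 : ℕ) : ℤ), (∀ δ ∈ GreenbergSelmer.decomp u, δ • x = x) → x = 0))
    (hL5 : ∀ κ : ZpExtension ℚ 3, κ.IsCyclotomic →
      haveI := κ.isGalois_layer_holds (0 + 1)
      haveI := κ.finiteDimensional_layer_holds (0 + 1)
      haveI : NumberField ↥(W.divisionField 3 ⊔ κ.layer (0 + 1)) := NumberField.of_module_finite ℚ _
      ∀ (f : Additive (ClassGroup (𝓞 ↥(W.divisionField 3 ⊔ κ.layer (0 + 1)))) →+ geomTorsion W ((3 : ℕ) : ℤ)),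
      (∀ (τ : absoluteGaloisGroup ℚ) (c : ClassGroup (𝓞 ↥(W.divisionField 3 ⊔ κ.layer (0 + 1)))),
        f (Additive.ofMul (ClassGroup.mulEquiv (AmbiguousClass.intAut
          (absRestrictNormalHom (W.divisionField 3 ⊔ κ.layer (0 + 1)) τ)) c)) = τ • f (Additive.ofMul c)) →
      (∀ (w : HeightOneSpectrum (𝓞 ↥(W.divisionField 3 ⊔ κ.layer (0 + 1)))) (u : HeightOneSpectrum (𝓞 ℚ)),
          (((3 : ℕ) : 𝓞 ℚ) ∈ u.asIdeal ∨ bad u) → w.asIdeal.under (𝓞 ℚ) = u.asIdeal →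
        f (Additive.ofMul (ClassGroup.mk0 ⟨w.asIdeal, mem_nonZeroDivisors_of_ne_zero w.ne_bot⟩)) = 0) →
      f = 0) :
    MissingUpperBoundAt W 3 :=
  WildFineSelmerSupersingularCMAnchor.missingUpperBoundAt_wild_of_conjA hKatoA hGZK hmod W hr hO hirr
    (fun κ hκ => conjA_three_layer_one_of_Δ_eq_cube W hirr hΔ bad hbad hL5 κ hκ)

/-- **U₀ at a K9 row from door L5 at layer 1, S-form (S)** — as above with the non-equivariant datum `hS` («the S-classes generate `Cl(L₁) ⊗ 𝔽₃`»), modulo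
`hKatoA hGZK hmod` ONLY. CONDITIONAL; nothing booked.
[cite: Kato2004Asterisque, Thm. 14.5 (3) (p. 236) and Prop. 14.16 (2)] [cite: CoatesSujatha2005, §3 Thm. 3.4] [cite: DeoRaySujatha2023, §3 Thm. 3.8] -/
theorem missingUpperBoundAt_three_layer_one_of_Δ_eq_cube_of_sClasses
    (hKatoA : Kato2004.rankZero_padicValNat_sha_add_padicValNat_tamagawa_le_of_additive_potGood_of_irreducible_of_fineSelmerDual_fg)
    (hGZK : rank_eq_analyticRank_of_analyticRank_le_one) (hmod : hasEntireLFunction_rat)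
    (W : WeierstrassCurve ℚ) [W.IsElliptic] [W.IsGloballyMinimal] [Fact (3 : ℕ).Prime]
    (hr : W.analyticRank = 0) (hO : ClassO6 W 3) (hirr : W.HasIrreducibleModPGaloisRep 3) {d : ℚ} (hΔ : W.Δ = d ^ 3)
    (bad : HeightOneSpectrum (𝓞 ℚ) → Prop)
    (hbad : ∀ κ : ZpExtension ℚ 3, κ.IsCyclotomic → ∀ u : HeightOneSpectrum (𝓞 ℚ), bad u →
      ¬ (GreenbergSelmer.decomp u ≤ κ.layerSubgroup (0 + 1)) ∨
      (∀ x : geomTorsion W ((3 : ℕ) : ℤ), (∀ δ ∈ GreenbergSelmer.decomp u, δ • x = x) → x = 0))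
    (hS : ∀ κ : ZpExtension ℚ 3, κ.IsCyclotomic →
      haveI := κ.isGalois_layer_holds (0 + 1)
      haveI := κ.finiteDimensional_layer_holds (0 + 1)
      haveI : NumberField ↥(W.divisionField 3 ⊔ κ.layer (0 + 1)) := NumberField.of_module_finite ℚ _
      ∀ (f : Additive (ClassGroup (𝓞 ↥(W.divisionField 3 ⊔ κ.layer (0 + 1)))) →+ geomTorsion W ((3 : ℕ) : ℤ)),
      (∀ (w : HeightOneSpectrum (𝓞 ↥(W.divisionField 3 ⊔ κ.layer (0 + 1)))) (u : HeightOneSpectrum (𝓞 ℚ)),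
          (((3 : ℕ) : 𝓞 ℚ) ∈ u.asIdeal ∨ bad u) → w.asIdeal.under (𝓞 ℚ) = u.asIdeal →
        f (Additive.ofMul (ClassGroup.mk0 ⟨w.asIdeal, mem_nonZeroDivisors_of_ne_zero w.ne_bot⟩)) = 0) →
      f = 0) :
    MissingUpperBoundAt W 3 :=
  WildFineSelmerSupersingularCMAnchor.missingUpperBoundAt_wild_of_conjA hKatoA hGZK hmod W hr hO hirr
    (fun κ hκ => conjA_three_layer_one_of_Δ_eq_cube_of_sClasses W hirr hΔ bad hbad hS κ hκ)

/-- **U₀ at a K9 row from door L5 at layer 1, class-number form (C)** — `MissingUpperBoundAt E 3` from `r_an = 0`, `ClassO6 E 3`, `E[3]` irreducible,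
`Δ(E)` a cube and `3 ∤ h(L₁)` for every cyclotomic `κ`, modulo `hKatoA hGZK hmod` ONLY. CONDITIONAL; nothing booked.
[cite: Kato2004Asterisque, Thm. 14.5 (3) (p. 236) and Prop. 14.16 (2)] [cite: CoatesSujatha2005, §3 Thm. 3.4] [cite: DeoRaySujatha2023, §3 Thm. 3.8] -/
theorem missingUpperBoundAt_three_layer_one_of_Δ_eq_cube_of_not_dvd_classNumber
    (hKatoA : Kato2004.rankZero_padicValNat_sha_add_padicValNat_tamagawa_le_of_additive_potGood_of_irreducible_of_fineSelmerDual_fg)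
    (hGZK : rank_eq_analyticRank_of_analyticRank_le_one) (hmod : hasEntireLFunction_rat)
    (W : WeierstrassCurve ℚ) [W.IsElliptic] [W.IsGloballyMinimal] [Fact (3 : ℕ).Prime]
    (hr : W.analyticRank = 0) (hO : ClassO6 W 3) (hirr : W.HasIrreducibleModPGaloisRep 3) {d : ℚ} (hΔ : W.Δ = d ^ 3)
    (hh : ∀ κ : ZpExtension ℚ 3, κ.IsCyclotomic →
      haveI := κ.isGalois_layer_holds (0 + 1)
      haveI := κ.finiteDimensional_layer_holds (0 + 1)
      haveI : NumberField ↥(W.divisionField 3 ⊔ κ.layer (0 + 1)) := NumberField.of_module_finite ℚ _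
      ¬ 3 ∣ NumberField.classNumber ↥(W.divisionField 3 ⊔ κ.layer (0 + 1))) :
    MissingUpperBoundAt W 3 :=
  WildFineSelmerSupersingularCMAnchor.missingUpperBoundAt_wild_of_conjA hKatoA hGZK hmod W hr hO hirr
    (fun κ hκ => conjA_three_layer_one_of_Δ_eq_cube_of_not_dvd_classNumber W hirr hΔ hh κ hκ)

end Summit.BirchSwinnertonDyer.BirchSwinnertonDyer.Theorems.WildFineSelmerLayerOneL5Door

end
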